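/-
Copyright (c) 2026. All rights reserved.
Released under Apache 2.0 license as described in the file LICENSE.
Authors: HodgeCM publication cell (pub-hodgecm), GR lane, seat GR-2 (`pub-hodgecm-own-hyp34`).
-/
import Literature.NumberTheory.GelbartRogawski1991.Prop311PrintedCMLeg
import Literature.NumberTheory.GelbartRogawski1991.Prop311RationalSplittingExists
import Literature.NumberTheory.GelbartRogawski1991.Prop311SkewHermitianOrthogonalBasis
import HarnessLib

-- build-lane note (ops-buildfix G11b-3 recipe): dependent telescopes of the CM dual-pair datum; elaborate sequentially.
set_option Elab.async false

/-!
# [GelbartRogawski1991, Prop. 3.1.1] AS PRINTED at CM data, FRAME-FREE: from `Mp` legs over the adelic Darboux frames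

Topic `NumberTheory/GelbartRogawski1991`; namespace `Literature.NumberTheory.GelbartRogawski1991.Prop311`.
One `Prop`-valued definition (the input predicate `DarbouxLegs`) and proved lemmas; nothing of [GelbartRogawski1991]
or [Weil1964] is asserted; `Prop311AsPrinted` is untouched.

The frame files of this topic reduce the statement-exact typing `Prop311AsPrinted` of [GelbartRogawski1991, Prop. 3.1.1]
at CM data to the tree's kernel construction `GRConstruction.gru_shape` plus ONE analytic input, a comparison of
metaplectic models (`Prop311PrintedCMLeg.printed_conclusion_CM_of_darbouxLeg`): a continuous homomorphism
`φ₁ : Mp_ψ(𝐀ⁿ × 𝐀ⁿ, std)ᶜᵒⁿᵗ →* Mp_𝐀(W)` (the tree's smooth model `Weil1964.adelicMpCont F (Fin n) 1` → print's group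
of pairs over `ρ_ψ`) lying over the Darboux frame `darbouxFrame b f e` of a CHOSEN `Φ`-orthogonal `E`-frame `(b, f)`.
This file removes the frame from the interface.

* §1 **`DarbouxLegs F E V Φ ρ n`** — the input predicate, stated on the objects of `Prop311AsPrinted` only: EVERY adelic
  Darboux frame `e : 𝐀ⁿ × 𝐀ⁿ ≃ₗ[𝐀] W_𝐀` (`φ_𝐀(e c, e c') = c.1 ⬝ᵥ c'.2 − c'.1 ⬝ᵥ c.2`, the normalisation of
  `Prop311AdelicCoordinates.exists_adelicDarboux`) carries a continuous homomorphism
  `φ₁ : Mp_ψ(𝐀ⁿ × 𝐀ⁿ, std)ᶜᵒⁿᵗ →* Mp_𝐀(W)` over it (`π(φ₁ m) ∘ e = e ∘ π₁(m)`);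
* §2 **`existsUnique_isRationalSplitting_of_darbouxLegs`** (any quadratic `E/F`): under `DarbouxLegs`, for `(V, Φ)`
  skew-Hermitian with `φ = Tr Φ` non-degenerate and `ρ` isometric irreducible, "*`π` splits uniquely over `Sp_F(W)`*"
  (p. 454 L35–36) holds for the printed objects: `∃! i, IsRationalSplitting i` — so the binders `(i, _hi, _hi!)` of
  `Prop311AsPrinted` are (uniquely) inhabited;
* §3 **`exists_isRationalSplitting_printed_conclusion_CM_of_darbouxLeg`** (CM data, a GIVEN `Φ`-orthogonal frame, ONE
  continuous leg over its Darboux frame, NO splitting binder): THE rational splitting `i` (exists and is unique) together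
  with clauses (1)+(2) for `(ρ, i)` — the binders `(i, _hi, _hi!)` and the conclusion of `Prop311AsPrinted` at this model
  (`Prop311RationalSplittingExists` + `rationalSplitting_unique'` + `printed_conclusion_CM_of_darbouxLeg`);
* §4 **`printed_conclusion_CM_of_darbouxLegs`**: `L` a CM field, `F = L⁺`, `E = L`, `σ` = complex conjugation; for the
  binders of `Prop311AsPrinted` at these parameters (`(V, Φ)` skew-Hermitian of `E`-dimension `n`, `φ` non-degenerate,
  `ρ` isometric irreducible, `i` a rational splitting) and `DarbouxLegs L⁺ L V Φ ρ n`, clauses (1) and (2) of Prop. 3.1.1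
  hold VERBATIM as rendered in `Prop311AsPrinted` (a `Φ`-orthogonal frame exists by
  `Prop311SkewHermitianOrthogonalBasis.exists_orthogonal_basis_imaginary`; `_hi!` by `rationalSplitting_unique'`);
  **`prop311_CM_of_darbouxLegs`** packages §2 + §4.

So at CM data the printed proposition is reduced to `DarbouxLegs` ALONE (the metaplectic model comparison of
[Weil1964, Chap. I n° 11–13, Chap. III n° 35–39]); the unused printed binders (`ψ`, continuity of `ρ`, central
character) are exactly those the leg construction consumes.

## References
* [GelbartRogawski1991] S. Gelbart, J. Rogawski, Invent. Math. 105 (1991) 445–472, §3.1 p. 454 L17–42, Prop. 3.1.1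
  p. 455 L1–2.
* [Weil1964] A. Weil, Acta Math. 111 (1964) 143–211, Chap. I n° 11–13, Chap. III n° 35–40.
* [Mok2014] C. P. Mok, Mem. AMS 235 (2015), §1 (unitary groups over CM fields).
-/

set_option autoImplicit false

noncomputable section

open NumberField
open scoped TensorProduct Matrix Kronecker
open Literature.NumberTheory.Automorphic
open Literature.NumberTheory.Automorphic.UnitaryGroup
open Literature.RepresentationTheory.HeisenbergGroup
open Literature.NumberTheory.Weil1964

namespace Literature.NumberTheory.GelbartRogawski1991

namespace Prop311

open UnitaryDualPair

/-! ## §1. The input predicate: `Mp` legs over the adelic Darboux frames -/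

section Legs

variable (F : Type) [Field F] [NumberField F]
variable (E : Type) [Field E] [Algebra F E]
variable (V : Type) [AddCommGroup V] [Module F V] [Module E V] [IsScalarTower F E V]
variable (Φ : V →ₗ[F] V →ₗ[F] E)
variable {S : Type} [NormedAddCommGroup S] [InnerProductSpace ℂ S]
variable (ρ : Representation ℂ (AdelicHeisenberg F E V Φ) S)

/-- **`DarbouxLegs F E V Φ ρ n` — the comparison of metaplectic models, frame-free.**  For the printed data
`(F, E, V, Φ)` and a printed model `ρ` of `ρ_ψ` (objects of `Prop311AsPrinted`): every adelic Darboux frame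
`e : 𝐀ⁿ × 𝐀ⁿ ≃ₗ[𝐀] W_𝐀` of `φ_𝐀 = Tr(Φ) ⊗ 𝐀` (`φ_𝐀(e c, e c') = c.1 ⬝ᵥ c'.2 - c'.1 ⬝ᵥ c.2`, the normalisation of
`Prop311AdelicCoordinates.exists_adelicDarboux`) carries a continuous homomorphism from the smooth metaplectic group
of the standard form `Mp_ψ(𝐀ⁿ × 𝐀ⁿ, std)ᶜᵒⁿᵗ` (`Weil1964.adelicMpCont F (Fin n) 1`) to print's `Mp_𝐀(W)` lying over
`e`: `π(φ₁ m) ∘ e = e ∘ π₁(m)`.  (The operators `M_g` of [GelbartRogawski1991, p. 454 L21–24] preserve the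
Schwartz–Bruhat model: [Weil1964, Chap. I n° 11–13, Chap. III n° 39].)  A hypothesis predicate — nothing is asserted.
[cite: GelbartRogawski1991, §3.1 p. 454 L17–30; Weil1964, Chap. III n° 39 p. 189] -/
def DarbouxLegs (n : ℕ) : Prop :=
  ∀ e : ((Fin n → AdeleRing (𝓞 F) F) × (Fin n → AdeleRing (𝓞 F) F)) ≃ₗ[AdeleRing (𝓞 F) F] AdelicSpace F V,
    (∀ c c' : (Fin n → AdeleRing (𝓞 F) F) × (Fin n → AdeleRing (𝓞 F) F),
        adelicTraceForm F E V Φ (e c) (e c') = c.1 ⬝ᵥ c'.2 - c'.1 ⬝ᵥ c.2) →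
      ∃ φ₁ : adelicMpCont F (Fin n) (1 : Matrix (Fin n) (Fin n) (AdeleRing (𝓞 F) F)) →* adelicMp F E V Φ ρ,
        Continuous φ₁ ∧
          ∀ (m₁ : adelicMpCont F (Fin n) (1 : Matrix (Fin n) (Fin n) (AdeleRing (𝓞 F) F)))
            (c : (Fin n → AdeleRing (𝓞 F) F) × (Fin n → AdeleRing (𝓞 F) F)),
            ((proj F E V Φ ρ (φ₁ m₁) : adelicSp F E V Φ) :
                AdelicSpace F V ≃ₗ[AdeleRing (𝓞 F) F] AdelicSpace F V) (e c) =
              e (((adelicMpCont.proj F (Fin n) (1 : Matrix (Fin n) (Fin n) (AdeleRing (𝓞 F) F)) m₁ :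
                    symplecticGroup (polar (adelicForm F (Fin n)
                      (1 : Matrix (Fin n) (Fin n) (AdeleRing (𝓞 F) F))))) :
                  ((Fin n → AdeleRing (𝓞 F) F) × (Fin n → AdeleRing (𝓞 F) F)) ≃ₗ[AdeleRing (𝓞 F) F]
                    ((Fin n → AdeleRing (𝓞 F) F) × (Fin n → AdeleRing (𝓞 F) F))) c)

end Legs

/-! ## §2. "`π` splits uniquely over `Sp_F(W)`" for the printed objects, from the legs (any quadratic `E/F`) -/

section RationalSplitting

variable (F : Type) [Field F] [NumberField F]
variable (E : Type) [Field E] [NumberField E] [Algebra F E] [Algebra.IsQuadraticExtension F E]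
variable (σ : E ≃ₐ[F] E) {δ : E} (hσδ : σ δ = -δ) (hδ : δ ≠ 0) {d : F} (hd : δ * δ = algebraMap F E d)
variable {n : ℕ} (V : Type) [AddCommGroup V] [Module F V] [Module E V] [IsScalarTower F E V] [FiniteDimensional E V]
variable (Φ : V →ₗ[F] V →ₗ[F] E)
variable {S : Type} [NormedAddCommGroup S] [InnerProductSpace ℂ S] [CompleteSpace S]
variable (ρ : Representation ℂ (AdelicHeisenberg F E V Φ) S)

include hσδ hδ hd in
/-- **[GR91 p. 454 L35–36] "`π` splits uniquely over the group of `F`-rational points `Sp_F(W)`" for the PRINTED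
objects, from the legs** (any quadratic extension of number fields `E/F` with conjugation `σ`, `σ δ = -δ ≠ 0`): for
`(V, Φ)` skew-Hermitian of `E`-dimension `n` with `φ = Tr Φ` non-degenerate and a printed model `ρ` (isometric,
irreducible), `DarbouxLegs F E V Φ ρ n` gives EXACTLY ONE rational splitting `i` of `π` — existence by
`exists_isRationalSplitting_of_darbouxLeg` at the Darboux frame of a `Φ`-orthogonal frame
(`exists_orthogonal_basis_imaginary`), uniqueness by `rationalSplitting_unique'`.  The binders `(i, _hi, _hi!)` of
`Prop311AsPrinted` are inhabited. [cite: GelbartRogawski1991, §3.1 p. 454 L35–36; Weil1964, Chap. III n° 40] -/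
theorem existsUnique_isRationalSplitting_of_darbouxLegs (hn : Module.finrank E V = n)
    (hΦ₁ : ∀ (a : E) (x y : V), Φ (a • x) y = a * Φ x y) (hΦ₂ : ∀ (a : E) (x y : V), Φ x (a • y) = Φ x y * σ a)
    (hΦ₃ : ∀ x y : V, Φ y x = -σ (Φ x y)) (hφ : (traceForm F E V Φ).Nondegenerate)
    (hρu : ∀ (h : AdelicHeisenberg F E V Φ) (v : S), ‖ρ h v‖ = ‖v‖)
    (hρi : ∀ K : Submodule ℂ S, IsClosed (K : Set S) →
      (∀ (h : AdelicHeisenberg F E V Φ), ∀ v ∈ K, ρ h v ∈ K) → K = ⊥ ∨ K = ⊤)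
    (legs : DarbouxLegs F E V Φ ρ n) :
    ∃! i : ratSp F E V Φ →* adelicMp F E V Φ ρ, IsRationalSplitting F E V Φ ρ i := by
  subst hn
  have hframe := exists_orthogonal_basis_imaginary F E σ hσδ hδ hd Φ hΦ₁ hΦ₃
  obtain ⟨b, f, hb, hf⟩ := hframe
  have hT : IsUnit (symplecticGram F d f).det :=
    isUnit_det_symplecticGram F f (d_ne_zero F E hδ hd)
      (frame_ne_zero_of_nondegenerate F E σ V b Φ f hΦ₁ hΦ₂ hb hf hφ)
  have hleg := legs (darbouxFrame F E σ hσδ hδ hd V b f (lineIndex _) hT)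
    (adelicTraceForm_darbouxFrame F E σ hσδ hδ hd V b Φ f (lineIndex _) (lineIndex_symm_fst) hT hΦ₁ hΦ₂ hb hf)
  obtain ⟨φ₁, -, hproj₁⟩ := hleg
  exact existsUnique_isRationalSplitting_of_darbouxLeg F E σ hσδ hδ hd V b Φ f ρ (lineIndex _) (lineIndex_symm_fst)
    hΦ₁ hΦ₂ hΦ₃ hb hf hφ hT hρu hρi φ₁ hproj₁

end RationalSplitting

/-! ## §3. At CM data in a GIVEN frame: the rational splitting and the printed conclusion together, from one leg -/

section CMFrame

variable (L : Type) [Field L] [NumberField L] [IsCMField L]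
variable {n : ℕ} (f : Fin n → ↥(maximalRealSubfield L))
variable (e : Fin n × Fin 1 ≃ Fin n) (he : ∀ k : Fin n, (e.symm k).1 = k)
-- `V` an `L`-space; its `L⁺`-structure is Mathlib's restriction (no separate binder).
variable (V : Type) [AddCommGroup V] [Module L V]
variable (b : Module.Basis (Fin n) L V) (Φ : V →ₗ[↥(maximalRealSubfield L)] V →ₗ[↥(maximalRealSubfield L)] L)
variable {S : Type} [NormedAddCommGroup S] [InnerProductSpace ℂ S] [CompleteSpace S]
variable (ρ : Representation ℂ (AdelicHeisenberg (↥(maximalRealSubfield L)) L V Φ) S)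

include he in
/-- **[We] + [GelbartRogawski1991, Prop. 3.1.1] AS PRINTED AT CM DATA in a given frame, from ONE leg — no splitting
binder.**  `L` a CM field, `F = L⁺`, `σ` = complex conjugation; `(V, Φ)` skew-Hermitian with `φ = Tr Φ` non-degenerate,
a `Φ`-orthogonal `L`-basis `b` with `Φ(bᵢ, bᵢ) = fᵢ δ`, `ρ` a printed model of `ρ_ψ` (isometric, irreducible).  A continuous
homomorphism `φ₁ : Mp_ψ(𝐀ⁿ × 𝐀ⁿ, std)ᶜᵒⁿᵗ →* Mp_𝐀(W)` over `darbouxFrame b f e` yields THE rational splitting `i` of `π`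
(exists: `exists_isRationalSplitting_of_darbouxLeg`; unique: `rationalSplitting_unique'`) together with clauses (1) and (2)
of Prop. 3.1.1 for `(ρ, i)` verbatim (`printed_conclusion_CM_of_darbouxLeg`) — i.e. the binders `(i, _hi, _hi!)` AND the
conclusion of `Prop311AsPrinted` at this model, ready for a model-independence transport.
[cite: GelbartRogawski1991, §3.1 p. 454 L35–36; Prop. 3.1.1 p. 455 L1–2] -/
theorem exists_isRationalSplitting_printed_conclusion_CM_of_darbouxLeg
    (hΦ₁ : ∀ (a : L) (x y : V), Φ (a • x) y = a * Φ x y)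
    (hΦ₂ : ∀ (a : L) (x y : V), Φ x (a • y) = Φ x y * IsCMField.complexConj L a)
    (hΦ₃ : ∀ x y : V, Φ y x = -IsCMField.complexConj L (Φ x y))
    (hb : ∀ i j, i ≠ j → Φ (b i) (b j) = 0)
    (hf : ∀ i, Φ (b i) (b i) = algebraMap (↥(maximalRealSubfield L)) L (f i) * imagUnit L)
    (hφ : (traceForm (↥(maximalRealSubfield L)) L V Φ).Nondegenerate)
    (hρu : ∀ (h : AdelicHeisenberg (↥(maximalRealSubfield L)) L V Φ) (v : S), ‖ρ h v‖ = ‖v‖)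
    (hρi : ∀ K : Submodule ℂ S, IsClosed (K : Set S) →
      (∀ (h : AdelicHeisenberg (↥(maximalRealSubfield L)) L V Φ), ∀ v ∈ K, ρ h v ∈ K) → K = ⊥ ∨ K = ⊤)
    (φ₁ : adelicMpCont (↥(maximalRealSubfield L)) (Fin n)
        (1 : Matrix (Fin n) (Fin n) (AdeleRing (𝓞 ↥(maximalRealSubfield L)) ↥(maximalRealSubfield L))) →*
      adelicMp (↥(maximalRealSubfield L)) L V Φ ρ) (hφ₁ : Continuous φ₁)
    (hproj₁ : ∀ (m₁ : adelicMpCont (↥(maximalRealSubfield L)) (Fin n)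
          (1 : Matrix (Fin n) (Fin n) (AdeleRing (𝓞 ↥(maximalRealSubfield L)) ↥(maximalRealSubfield L))))
        (c : (Fin n → AdeleRing (𝓞 ↥(maximalRealSubfield L)) ↥(maximalRealSubfield L)) ×
          (Fin n → AdeleRing (𝓞 ↥(maximalRealSubfield L)) ↥(maximalRealSubfield L))),
      ((proj (↥(maximalRealSubfield L)) L V Φ ρ (φ₁ m₁) : adelicSp (↥(maximalRealSubfield L)) L V Φ) :
            AdelicSpace (↥(maximalRealSubfield L)) V ≃ₗ[AdeleRing (𝓞 ↥(maximalRealSubfield L)) ↥(maximalRealSubfield L)]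
              AdelicSpace (↥(maximalRealSubfield L)) V)
          (darbouxFrame (↥(maximalRealSubfield L)) L (IsCMField.complexConj L) (complexConj_imagUnit L)
            (imagUnit_ne_zero L) (imagUnit_mul_self L) V b f e (isUnit_det_cmLineGram_of_nondegenerate L f V b Φ hΦ₁ hΦ₂ hb hf hφ) c) =
        darbouxFrame (↥(maximalRealSubfield L)) L (IsCMField.complexConj L) (complexConj_imagUnit L)
            (imagUnit_ne_zero L) (imagUnit_mul_self L) V b f e (isUnit_det_cmLineGram_of_nondegenerate L f V b Φ hΦ₁ hΦ₂ hb hf hφ)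
          (((adelicMpCont.proj (↥(maximalRealSubfield L)) (Fin n)
                (1 : Matrix (Fin n) (Fin n) (AdeleRing (𝓞 ↥(maximalRealSubfield L)) ↥(maximalRealSubfield L))) m₁ :
              symplecticGroup (polar (adelicForm (↥(maximalRealSubfield L)) (Fin n)
                (1 : Matrix (Fin n) (Fin n) (AdeleRing (𝓞 ↥(maximalRealSubfield L)) ↥(maximalRealSubfield L)))))) :
            ((Fin n → AdeleRing (𝓞 ↥(maximalRealSubfield L)) ↥(maximalRealSubfield L)) ×
                (Fin n → AdeleRing (𝓞 ↥(maximalRealSubfield L)) ↥(maximalRealSubfield L))) ≃ₗ[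
                AdeleRing (𝓞 ↥(maximalRealSubfield L)) ↥(maximalRealSubfield L)]
              ((Fin n → AdeleRing (𝓞 ↥(maximalRealSubfield L)) ↥(maximalRealSubfield L)) ×
                (Fin n → AdeleRing (𝓞 ↥(maximalRealSubfield L)) ↥(maximalRealSubfield L)))) c)) :
    ∃ i : ratSp (↥(maximalRealSubfield L)) L V Φ →* adelicMp (↥(maximalRealSubfield L)) L V Φ ρ,
      IsRationalSplitting (↥(maximalRealSubfield L)) L V Φ ρ i ∧
      (∀ i' : ratSp (↥(maximalRealSubfield L)) L V Φ →* adelicMp (↥(maximalRealSubfield L)) L V Φ ρ,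
        IsRationalSplitting (↥(maximalRealSubfield L)) L V Φ ρ i' → i' = i) ∧
      (∃ s : adelicUnitary (↥(maximalRealSubfield L)) L V Φ →* adelicMp (↥(maximalRealSubfield L)) L V Φ ρ,
          ∀ g : adelicUnitary (↥(maximalRealSubfield L)) L V Φ,
            projEnd (↥(maximalRealSubfield L)) L V Φ ρ (s g) =
              ((g : AdelicSpace (↥(maximalRealSubfield L)) V ≃ₗ[AdeleRing (𝓞 ↥(maximalRealSubfield L)) ↥(maximalRealSubfield L)]
                  AdelicSpace (↥(maximalRealSubfield L)) V) :
                AdelicSpace (↥(maximalRealSubfield L)) V →ₗ[AdeleRing (𝓞 ↥(maximalRealSubfield L)) ↥(maximalRealSubfield L)]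
                  AdelicSpace (↥(maximalRealSubfield L)) V)) ∧
        ∃ s : adelicUnitary (↥(maximalRealSubfield L)) L V Φ →* adelicMp (↥(maximalRealSubfield L)) L V Φ ρ,
          Continuous s ∧
          (∀ g : adelicUnitary (↥(maximalRealSubfield L)) L V Φ,
            projEnd (↥(maximalRealSubfield L)) L V Φ ρ (s g) =
              ((g : AdelicSpace (↥(maximalRealSubfield L)) V ≃ₗ[AdeleRing (𝓞 ↥(maximalRealSubfield L)) ↥(maximalRealSubfield L)]
                  AdelicSpace (↥(maximalRealSubfield L)) V) :
                AdelicSpace (↥(maximalRealSubfield L)) V →ₗ[AdeleRing (𝓞 ↥(maximalRealSubfield L)) ↥(maximalRealSubfield L)]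
                  AdelicSpace (↥(maximalRealSubfield L)) V)) ∧
          ∀ g : adelicUnitary (↥(maximalRealSubfield L)) L V Φ,
            IsRationalPoint (↥(maximalRealSubfield L)) L V Φ
                (g : AdelicSpace (↥(maximalRealSubfield L)) V ≃ₗ[AdeleRing (𝓞 ↥(maximalRealSubfield L)) ↥(maximalRealSubfield L)]
                  AdelicSpace (↥(maximalRealSubfield L)) V) →
              s g ∈ i.range := by
  haveI : FiniteDimensional L V := Module.Finite.of_basis b
  have hex := exists_isRationalSplitting_of_darbouxLeg (↥(maximalRealSubfield L)) L (IsCMField.complexConj L)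
    (complexConj_imagUnit L) (imagUnit_ne_zero L) (imagUnit_mul_self L) V b Φ f ρ e he hΦ₁ hΦ₂ hb hf hφ
    (isUnit_det_cmLineGram_of_nondegenerate L f V b Φ hΦ₁ hΦ₂ hb hf hφ) φ₁ hproj₁
  obtain ⟨i, hi⟩ := hex
  have hi! : ∀ i' : ratSp (↥(maximalRealSubfield L)) L V Φ →* adelicMp (↥(maximalRealSubfield L)) L V Φ ρ,
      IsRationalSplitting (↥(maximalRealSubfield L)) L V Φ ρ i' → i' = i := fun i' hi' =>
    rationalSplitting_unique' (↥(maximalRealSubfield L)) L V Φ ρ (IsCMField.complexConj L) hΦ₃ hφ hρu hρi i i' hi hi'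
  exact ⟨i, hi, hi!, printed_conclusion_CM_of_darbouxLeg L f e he V b Φ ρ i hi hΦ₁ hΦ₂ hb hf hφ hi! φ₁ hφ₁ hproj₁⟩

end CMFrame

/-! ## §4. The printed proposition at CM data from the legs, frame-free -/

section CM

variable (L : Type) [Field L] [NumberField L] [IsCMField L]
variable {n : ℕ}
-- `V` an `L`-space; its `L⁺`-structure is Mathlib's restriction (no separate binder).
variable (V : Type) [AddCommGroup V] [Module L V] [FiniteDimensional L V]
variable (Φ : V →ₗ[↥(maximalRealSubfield L)] V →ₗ[↥(maximalRealSubfield L)] L)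
variable {S : Type} [NormedAddCommGroup S] [InnerProductSpace ℂ S] [CompleteSpace S]
variable (ρ : Representation ℂ (AdelicHeisenberg (↥(maximalRealSubfield L)) L V Φ) S)
variable (i : ratSp (↥(maximalRealSubfield L)) L V Φ →* adelicMp (↥(maximalRealSubfield L)) L V Φ ρ)
variable (hi : IsRationalSplitting (↥(maximalRealSubfield L)) L V Φ ρ i)

include hi in
/-- **[GelbartRogawski1991, Prop. 3.1.1] AS PRINTED AT CM DATA, FRAME-FREE, from the `Mp` legs.**  `L` a CM field,
`F = L⁺`, `E = L`, `σ` the complex conjugation; binders of `Prop311AsPrinted` at these parameters: `(V, Φ)`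
skew-Hermitian of `E`-dimension `n` (`Φ(a x, y) = a Φ(x, y)`, `Φ(x, a y) = Φ(x, y) ā`, `Φ(y, x) = -Φ(x, y)‾`),
`φ = Tr Φ` non-degenerate, `ρ` a printed model of `ρ_ψ` (isometric, irreducible), `i` a rational splitting (`_hi`;
`_hi!` then holds, `rationalSplitting_unique'`).  If every adelic Darboux frame carries an `Mp` leg (`DarbouxLegs`),
then (1) "*The covering `π` splits over `G(𝐀)`*" and (2) "*There exists a continuous section `s : G(𝐀) → Mp_𝐀(W)` such
that `s(G(F))` is contained in `i(Sp_F(W))`*" hold verbatim as rendered in `Prop311AsPrinted` — the splitting being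
`GRConstruction.gru_shape`'s, read in a `Φ`-orthogonal frame (`exists_orthogonal_basis_imaginary`) through
`printed_conclusion_CM_of_darbouxLeg`. [cite: GelbartRogawski1991, §3.1 p. 454 L17–42; Prop. 3.1.1 p. 455 L1–2] -/
theorem printed_conclusion_CM_of_darbouxLegs (hn : Module.finrank L V = n)
    (hΦ₁ : ∀ (a : L) (x y : V), Φ (a • x) y = a * Φ x y)
    (hΦ₂ : ∀ (a : L) (x y : V), Φ x (a • y) = Φ x y * IsCMField.complexConj L a)
    (hΦ₃ : ∀ x y : V, Φ y x = -IsCMField.complexConj L (Φ x y))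
    (hφ : (traceForm (↥(maximalRealSubfield L)) L V Φ).Nondegenerate)
    (hρu : ∀ (h : AdelicHeisenberg (↥(maximalRealSubfield L)) L V Φ) (v : S), ‖ρ h v‖ = ‖v‖)
    (hρi : ∀ K : Submodule ℂ S, IsClosed (K : Set S) →
      (∀ (h : AdelicHeisenberg (↥(maximalRealSubfield L)) L V Φ), ∀ v ∈ K, ρ h v ∈ K) → K = ⊥ ∨ K = ⊤)
    (legs : DarbouxLegs (↥(maximalRealSubfield L)) L V Φ ρ n) :
    (∃ s : adelicUnitary (↥(maximalRealSubfield L)) L V Φ →* adelicMp (↥(maximalRealSubfield L)) L V Φ ρ,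
        ∀ g : adelicUnitary (↥(maximalRealSubfield L)) L V Φ,
          projEnd (↥(maximalRealSubfield L)) L V Φ ρ (s g) =
            ((g : AdelicSpace (↥(maximalRealSubfield L)) V ≃ₗ[AdeleRing (𝓞 ↥(maximalRealSubfield L)) ↥(maximalRealSubfield L)]
                AdelicSpace (↥(maximalRealSubfield L)) V) :
              AdelicSpace (↥(maximalRealSubfield L)) V →ₗ[AdeleRing (𝓞 ↥(maximalRealSubfield L)) ↥(maximalRealSubfield L)]
                AdelicSpace (↥(maximalRealSubfield L)) V)) ∧
      ∃ s : adelicUnitary (↥(maximalRealSubfield L)) L V Φ →* adelicMp (↥(maximalRealSubfield L)) L V Φ ρ,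
        Continuous s ∧
        (∀ g : adelicUnitary (↥(maximalRealSubfield L)) L V Φ,
          projEnd (↥(maximalRealSubfield L)) L V Φ ρ (s g) =
            ((g : AdelicSpace (↥(maximalRealSubfield L)) V ≃ₗ[AdeleRing (𝓞 ↥(maximalRealSubfield L)) ↥(maximalRealSubfield L)]
                AdelicSpace (↥(maximalRealSubfield L)) V) :
              AdelicSpace (↥(maximalRealSubfield L)) V →ₗ[AdeleRing (𝓞 ↥(maximalRealSubfield L)) ↥(maximalRealSubfield L)]
                AdelicSpace (↥(maximalRealSubfield L)) V)) ∧
        ∀ g : adelicUnitary (↥(maximalRealSubfield L)) L V Φ,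
          IsRationalPoint (↥(maximalRealSubfield L)) L V Φ
              (g : AdelicSpace (↥(maximalRealSubfield L)) V ≃ₗ[AdeleRing (𝓞 ↥(maximalRealSubfield L)) ↥(maximalRealSubfield L)]
                AdelicSpace (↥(maximalRealSubfield L)) V) →
            s g ∈ i.range := by
  subst hn
  -- (`have` first, then `obtain` on the local: destructuring the application directly makes `rcases` generalise the
  -- proof term over the large goal, which times out)
  have hframe := exists_orthogonal_basis_imaginary (↥(maximalRealSubfield L)) L (IsCMField.complexConj L)
    (complexConj_imagUnit L) (imagUnit_ne_zero L) (imagUnit_mul_self L) Φ hΦ₁ hΦ₃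
  obtain ⟨b, f, hb, hf⟩ := hframe
  have hT := isUnit_det_cmLineGram_of_nondegenerate L f V b Φ hΦ₁ hΦ₂ hb hf hφ
  have hleg := legs
    (darbouxFrame (↥(maximalRealSubfield L)) L (IsCMField.complexConj L) (complexConj_imagUnit L)
      (imagUnit_ne_zero L) (imagUnit_mul_self L) V b f (lineIndex _) hT)
    (adelicTraceForm_darbouxFrame (↥(maximalRealSubfield L)) L (IsCMField.complexConj L) (complexConj_imagUnit L)
      (imagUnit_ne_zero L) (imagUnit_mul_self L) V b Φ f (lineIndex _) (lineIndex_symm_fst) hT hΦ₁ hΦ₂ hb hf)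
  obtain ⟨φ₁, hφ₁, hproj₁⟩ := hleg
  exact printed_conclusion_CM_of_darbouxLeg L f (lineIndex _) (lineIndex_symm_fst) V b Φ ρ i hi hΦ₁ hΦ₂ hb hf hφ
    (fun i' hi' => rationalSplitting_unique' (↥(maximalRealSubfield L)) L V Φ ρ (IsCMField.complexConj L) hΦ₃ hφ
      hρu hρi i i' hi hi') φ₁ hφ₁ hproj₁

/-- **[We] + [GelbartRogawski1991, Prop. 3.1.1] at CM data from the legs**: under `DarbouxLegs`, (a) `π` has EXACTLY ONE
rational splitting `i` (p. 454 L35–36), and (b) for every rational splitting `i` the printed conclusion (1) ∧ (2) of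
Prop. 3.1.1 holds — the body of `Prop311AsPrinted` at `(L⁺, L, complexConj)`, its quantifier `∀ i (_hi) (_hi!)`
ranging over a singleton. [cite: GelbartRogawski1991, §3.1 p. 454 L35–36; Prop. 3.1.1 p. 455 L1–2] -/
theorem prop311_CM_of_darbouxLegs (hn : Module.finrank L V = n)
    (hΦ₁ : ∀ (a : L) (x y : V), Φ (a • x) y = a * Φ x y)
    (hΦ₂ : ∀ (a : L) (x y : V), Φ x (a • y) = Φ x y * IsCMField.complexConj L a)
    (hΦ₃ : ∀ x y : V, Φ y x = -IsCMField.complexConj L (Φ x y))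
    (hφ : (traceForm (↥(maximalRealSubfield L)) L V Φ).Nondegenerate)
    (hρu : ∀ (h : AdelicHeisenberg (↥(maximalRealSubfield L)) L V Φ) (v : S), ‖ρ h v‖ = ‖v‖)
    (hρi : ∀ K : Submodule ℂ S, IsClosed (K : Set S) →
      (∀ (h : AdelicHeisenberg (↥(maximalRealSubfield L)) L V Φ), ∀ v ∈ K, ρ h v ∈ K) → K = ⊥ ∨ K = ⊤)
    (legs : DarbouxLegs (↥(maximalRealSubfield L)) L V Φ ρ n) :
    (∃! i : ratSp (↥(maximalRealSubfield L)) L V Φ →* adelicMp (↥(maximalRealSubfield L)) L V Φ ρ,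
        IsRationalSplitting (↥(maximalRealSubfield L)) L V Φ ρ i) ∧
      ∀ i : ratSp (↥(maximalRealSubfield L)) L V Φ →* adelicMp (↥(maximalRealSubfield L)) L V Φ ρ,
        IsRationalSplitting (↥(maximalRealSubfield L)) L V Φ ρ i →
          ((∃ s : adelicUnitary (↥(maximalRealSubfield L)) L V Φ →* adelicMp (↥(maximalRealSubfield L)) L V Φ ρ,
              ∀ g : adelicUnitary (↥(maximalRealSubfield L)) L V Φ,
                projEnd (↥(maximalRealSubfield L)) L V Φ ρ (s g) =
                  ((g : AdelicSpace (↥(maximalRealSubfield L)) V ≃ₗ[AdeleRing (𝓞 ↥(maximalRealSubfield L)) ↥(maximalRealSubfield L)]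
                      AdelicSpace (↥(maximalRealSubfield L)) V) :
                    AdelicSpace (↥(maximalRealSubfield L)) V →ₗ[AdeleRing (𝓞 ↥(maximalRealSubfield L)) ↥(maximalRealSubfield L)]
                      AdelicSpace (↥(maximalRealSubfield L)) V)) ∧
            ∃ s : adelicUnitary (↥(maximalRealSubfield L)) L V Φ →* adelicMp (↥(maximalRealSubfield L)) L V Φ ρ,
              Continuous s ∧
              (∀ g : adelicUnitary (↥(maximalRealSubfield L)) L V Φ,
                projEnd (↥(maximalRealSubfield L)) L V Φ ρ (s g) =
                  ((g : AdelicSpace (↥(maximalRealSubfield L)) V ≃ₗ[AdeleRing (𝓞 ↥(maximalRealSubfield L)) ↥(maximalRealSubfield L)]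
                      AdelicSpace (↥(maximalRealSubfield L)) V) :
                    AdelicSpace (↥(maximalRealSubfield L)) V →ₗ[AdeleRing (𝓞 ↥(maximalRealSubfield L)) ↥(maximalRealSubfield L)]
                      AdelicSpace (↥(maximalRealSubfield L)) V)) ∧
              ∀ g : adelicUnitary (↥(maximalRealSubfield L)) L V Φ,
                IsRationalPoint (↥(maximalRealSubfield L)) L V Φ
                    (g : AdelicSpace (↥(maximalRealSubfield L)) V ≃ₗ[AdeleRing (𝓞 ↥(maximalRealSubfield L)) ↥(maximalRealSubfield L)]
                      AdelicSpace (↥(maximalRealSubfield L)) V) →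
                  s g ∈ i.range) :=
  ⟨existsUnique_isRationalSplitting_of_darbouxLegs (↥(maximalRealSubfield L)) L (IsCMField.complexConj L)
      (complexConj_imagUnit L) (imagUnit_ne_zero L) (imagUnit_mul_self L) V Φ ρ hn hΦ₁ hΦ₂ hΦ₃ hφ hρu hρi legs,
    fun i hi => printed_conclusion_CM_of_darbouxLegs L V Φ ρ i hi hn hΦ₁ hΦ₂ hΦ₃ hφ hρu hρi legs⟩

end CM

end Prop311

end Literature.NumberTheory.GelbartRogawski1991

end
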